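import Summits.AnomalousDissipation.AnomalousDissipation.Theorems.MomentParityMomentLadderStubTailLePalinstrophy
import Summits.AnomalousDissipation.AnomalousDissipation.Theorems.MomentParityMomentLadderStubEnstrophyTestField
import Summits.AnomalousDissipation.AnomalousDissipation.Theorems.MomentParityMomentLadderStubStokesTruncRow
import Summits.AnomalousDissipation.AnomalousDissipation.Theorems.MomentParityMomentLadderStubWeightStationarity
import Summits.AnomalousDissipation.AnomalousDissipation.Theorems.MomentParityMomentLadderStubWeightedPalinstrophyBound
import Summits.AnomalousDissipation.AnomalousDissipation.Theorems.MomentParityMomentLadderStubUIResolution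
import Summits.AnomalousDissipation.AnomalousDissipation.Theorems.MomentParityMomentLadderStubSteadyCorner
import Summits.AnomalousDissipation.AnomalousDissipation.Theorems.MomentParityMomentLadderStubClosureAllDegrees
import Summits.AnomalousDissipation.AnomalousDissipation.Theorems.MomentParityMomentLadderStubResolutionUI

/-!
# Line `Sketch` / card `enstrophy-ui-resolution` of the crux `MomentParity.MomentLadder`
# (stmt-AnomalousDissipation-11463): the kernel-checked TRANSFER `GalerkinInvariantLoudUI → MomentLadder`

The crux `MomentLadder` (route MomentParity, its target `X`) asks, along `ν_j → 0`, for loud level-`N` Galerkin laws that are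
supported in a ball, polynomially stationary at every order and `κ`-RESOLVED with a schedule `κ_j` UNIFORM IN THE LEVEL `N`
(`∫‖∇u‖² dμ ≤ ∫‖∇P_{κ(n)}u‖² dμ + 1/(n+1)`).  This file discharges the `κ`-clause from ONE scalar statistic of the law of the
enstrophy `Z = ‖∇u‖²`: a superlinear moment `∫ Ψ(Z) dμ ≤ B_j` (`Ψ(x)/x → ∞`), uniform in `N` — the de la Vallée-Poussin form of
UNIFORM INTEGRABILITY of `Z` along the levels.  The six analytic stubs of the line are landed theorems (imported):

* A1 `stub_tailLePalinstrophy` — spectral gap `Z u ≤ Z(P_K u) + ‖Δu‖²/(4π²(K²+1))`;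
* A2a `stub_enstrophyTestField`, A2b `stub_stokesTruncRow`, A2c `stub_weightStationarity`, A2d `stub_weightedPalinstrophyBound` —
  the N-UNIFORM WEIGHTED PALINSTROPHY BOUND `∫ ‖Δu‖²/(1+Z)² dμ ≤ C(f,ν,R)` for level-`N` probability laws supported in `‖u‖ ≤ R`
  and polynomially stationary at every degree (FMRT 2001 Ch. II App. B (B.9)–(B.11) at Galerkin level: stationarity of `p(Z)` for all
  polynomials `p`, Weierstrass to the weight `(1+Z)⁻²`, vortex stretching by FMRT (A.26b)+Young, `ν∫Z = ∫(u,f) ≤ ‖f‖R` by the energy row);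
* A3 `stub_uiResolution` — A1 + A2 + Chebyshev: ONE schedule `κ(f,ν,R,ω)` resolves every such law whose enstrophy has UI-modulus `ω`;
* B1 `stub_closureAllDegrees` (moment closure at EVERY degree, the internal lemmas of the landed `momentClosure_proof`, stmt-11467) and
  B2 `stub_resolutionUI` (resolution ⇒ UI with the explicit modulus `∫_{Z>8π²κ(n)²R²} Z ≤ 2/(n+1)`) — the CONVERSE direction;
* `stub_steadyCorner` — the STEADY CORNER: `MirrorVariety.GalerkinSteadyZerothLaw` (loud bounded Galerkin steady states, the sibling route's
  crux stmt-AnomalousDissipation-2986) gives the loud rung with `Ψ(x) = x²` (Dirac masses; the steady energy identity bounds the enstrophy).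

Proved here (sorry-free):
* `exists_uiModulus_of_superlinear` — de la Vallée-Poussin in `ℝ≥0∞`: a superlinear moment bound `∫Ψ(Z) ≤ B` gives an `N`-free
  modulus `ω M → 0` with `∫_{Z>M} Z ≤ ω M` (laws carried by level-`N` fields);
* `MomentLadder_of_galerkinInvariantLoudUI` — **the transfer**: the loud rung WITH ONE SUPERLINEAR ENSTROPHY MOMENT
  (`GalerkinInvariantLoudUI`, stated inline as the hypothesis: `∃ f` smooth div-free mean-zero, `ν_j → 0`, `E`, `ε > 0`, superlinear `Ψ`,
  `∀ j ∃ R B, B < ∞ ∧ ∃ᶠ N, ∃ μ` level-`N` probability law supported in `‖u‖ ≤ R`, polynomially stationary at every degree,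
  `∫Ψ(Z)dμ ≤ B`, energy `≤ E`, dissipation `≥ ε`) implies the route target `MomentParity.MomentLadder` BY NAME;
* `galerkinInvariantLoud_of_galerkinInvariantLoudUI` — the same hypothesis implies the sibling crux `MomentParity.GalerkinInvariantLoud`
  (stmt-AnomalousDissipation-14283) by forgetting `Ψ`: the residual hypothesis is at least crux-sized (it is the Galerkin-ensemble
  zeroth law plus a UI clause), which is why it is handed back to the planners rather than claimed;
* `MomentLadder_of_galerkinSteadyZerothLaw` — **cross-route bridge, unconditional implication between two route declarations**:
  `MirrorVariety.GalerkinSteadyZerothLaw → MomentParity.MomentLadder` (the route file's kill-criterion remark "GalerkinSteadyZerothLaw proved ⇒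
  MomentLadder holds with Dirac measures" made a theorem, RESOLUTION CLAUSE INCLUDED — which is exactly what the UI line buys: for Diracs at
  bounded steady states the enstrophy is deterministic and `N`-uniformly bounded, so UI is free while a κ-schedule uniform in `N` is not a priori).

* `MomentLadder_of_mod`, `mod_of_MomentLadder`, `momentLadder_iff_mod` — **the characterization**: `MomentLadder` ⟺ the loud Galerkin-invariant
  rung (sibling crux 14283's body, stationary at every polynomial degree) WITH A UNIFORMLY INTEGRABLE ENSTROPHY, `N`-free modulus `ω_j`
  (`∀ M, ∫_{Z>M} Z dμ ≤ ω_j M`, `ω_j → 0`). The κ-clause of the crux is EXACTLY uniform integrability of `‖∇u‖²` along the levels; nothing else.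

Consequence for the route: in the glue `LadderGlue : GalerkinInvariantLoud → ResolvedDissipation → MomentLadder` the universally
quantified fixed-`ν` crux `ResolvedDissipation` (stmt-14284: EVERY invariant law at EVERY level is resolved by one `κ(f,ν,R)`) is replaced
by an existential, witness-side scalar condition; on the steady corner (Diracs at bounded loud Galerkin steady states) and on every
uniformly-`H¹`-bounded corner the condition is free.

References: Foias–Manley–Rosa–Temam, *Navier–Stokes Equations and Turbulence* (CUP 2001), Ch. II App. B (B.9)–(B.12), Ch. IV §1.2,
§5 (5.13)–(5.27); Foias–Guillopé–Temam 1981 (weighted a-priori estimate); de la Vallée-Poussin / Fonseca–Leoni 2007 Thm 2.29.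
Line card: `Cruxes/MomentLadder/Ideas/enstrophy-ui-resolution.md`; skeleton `Cruxes/MomentLadder/Lines/Sketch.lean`.
-/

set_option linter.dupNamespace false

noncomputable section

namespace Summit.AnomalousDissipation.AnomalousDissipation.Theorems.MomentLadder

open MeasureTheory Filter Topology Set
open scoped ENNReal NNReal InnerProductSpace RealInnerProductSpace Polynomial
open Literature.Analysis.FunctionSpaces Literature.Analysis.FluidPDE
open Summit.AnomalousDissipation.AnomalousDissipation.Theses.MomentParity
open Summit.AnomalousDissipation.AnomalousDissipation.Theorems.QuarticGate.Negative
open Summit.AnomalousDissipation.AnomalousDissipation.Theorems.MomentLadder.Negative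

/-! ## de la Vallée-Poussin: a superlinear moment gives an `N`-free UI modulus -/

/-- In `ℝ≥0∞`, the punctured neighbourhood filter of `⊤` is the left-neighbourhood filter. [folklore] -/
theorem nhdsWithin_ne_top_eq : (𝓝[≠] (⊤ : ℝ≥0∞)) = 𝓝[<] ⊤ := by
  congr 1
  ext x
  simp [lt_top_iff_ne_top]

/-- If `Ψ x / x → ∞` as `x → ∞` in `ℝ≥0∞` (`x ≠ ∞`), then `s M := sup_{M < x < ∞} x / Ψ x → 0`. [folklore] -/
theorem tendsto_biSup_div_of_superlinear {Ψ : ℝ≥0∞ → ℝ≥0∞}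
    (hΨ : Tendsto (fun x : ℝ≥0∞ => Ψ x / x) (𝓝[≠] ⊤) (𝓝 ⊤)) :
    Tendsto (fun M : ℕ => ⨆ x ∈ Ioo (M : ℝ≥0∞) ⊤, x / Ψ x) atTop (𝓝 0) := by
  rw [ENNReal.tendsto_nhds_zero]
  intro ε hε
  by_cases hεT : ε = ⊤
  · exact Eventually.of_forall fun M => by rw [hεT]; exact le_top
  set c : ℝ≥0∞ := ε⁻¹ with hc
  have hcT : c < ⊤ := by
    rw [hc, lt_top_iff_ne_top]
    exact ENNReal.inv_ne_top.2 hε.ne'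
  have hmem : {x : ℝ≥0∞ | c < Ψ x / x} ∈ 𝓝[<] (⊤ : ℝ≥0∞) := by
    rw [← nhdsWithin_ne_top_eq]
    exact hΨ (Ioi_mem_nhds hcT)
  obtain ⟨l, hl, hsub⟩ := (mem_nhdsLT_iff_exists_Ioo_subset' (show (0 : ℝ≥0∞) < ⊤ from
    ENNReal.zero_lt_top)).1 hmem
  obtain ⟨M₀, hM₀⟩ := ENNReal.exists_nat_gt (lt_top_iff_ne_top.1 (mem_Iio.1 hl))
  refine eventually_atTop.2 ⟨M₀, fun M hM => ?_⟩
  refine iSup₂_le fun x hx => ?_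
  have hxl : x ∈ Ioo l ⊤ := ⟨hM₀.trans_le ((Nat.cast_le.2 hM).trans hx.1.le), hx.2⟩
  have hcx : c < Ψ x / x := hsub hxl
  have hx0 : x ≠ 0 := (lt_of_le_of_lt (zero_le (a := (M : ℝ≥0∞))) hx.1).ne'
  have hxT : x ≠ ⊤ := hx.2.ne
  by_cases hΨT : Ψ x = ⊤
  · rw [hΨT, ENNReal.div_top]; exact zero_le
  have hmul : c * x < Ψ x := (ENNReal.lt_div_iff_mul_lt (Or.inl hx0) (Or.inl hxT)).1 hcx
  have hΨ0 : Ψ x ≠ 0 := (lt_of_le_of_lt (zero_le (a := c * x)) hmul).ne'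
  rw [ENNReal.div_le_iff_le_mul (Or.inl hΨ0) (Or.inl hΨT)]
  calc x = ε * (c * x) := by
        rw [← mul_assoc, hc, ENNReal.mul_inv_cancel hε.ne' hεT, one_mul]
    _ ≤ ε * Ψ x := mul_le_mul' le_rfl hmul.le

/-- **de la Vallée-Poussin, modulus form (`ℝ≥0∞`).** If `Ψ x / x → ∞` as `x → ∞` (`x ≠ ∞`) and `B < ∞`, there is
ONE sequence `ω M → 0` such that every law carried by level-`N` fields (finite enstrophy a.e.) with `∫ Ψ(Z) dμ ≤ B`
has `∫_{Z > M} Z dμ ≤ ω M` for all `M`. [folklore] -/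
theorem exists_uiModulus_of_superlinear {Ψ : ℝ≥0∞ → ℝ≥0∞}
    (hΨ : Tendsto (fun x : ℝ≥0∞ => Ψ x / x) (𝓝[≠] ⊤) (𝓝 ⊤)) {B : ℝ≥0∞} (hB : B < ⊤) :
    ∃ ω : ℕ → ℝ≥0∞, Tendsto ω atTop (𝓝 0) ∧
      ∀ (μ : Measure (Torus.energySpace (Fin 3))) (N : ℕ), (∀ᵐ u ∂μ, IsLevel N u) →
        ∫⁻ u, Ψ (Torus.eGradNormSq (u.1 : UnitAddTorus (Fin 3) → EuclideanSpace ℝ (Fin 3))) ∂μ ≤ B →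
        ∀ M : ℕ, ∫⁻ u in {u : Torus.energySpace (Fin 3) |
            (M : ℝ≥0∞) < Torus.eGradNormSq (u.1 : UnitAddTorus (Fin 3) → EuclideanSpace ℝ (Fin 3))},
            Torus.eGradNormSq (u.1 : UnitAddTorus (Fin 3) → EuclideanSpace ℝ (Fin 3)) ∂μ ≤ ω M := by
  -- the modulus: `ω M = (B + 1) (s M + 1/(M+1))`, `s M = sup_{M < x < ∞} x / Ψ x`
  set s : ℕ → ℝ≥0∞ := fun M => ⨆ x ∈ Ioo (M : ℝ≥0∞) ⊤, x / Ψ x with hs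
  set t : ℕ → ℝ≥0∞ := fun M => s M + ((M : ℝ≥0∞) + 1)⁻¹ with ht
  refine ⟨fun M => (B + 1) * t M, ?_, fun μ N hlev hΨB M => ?_⟩
  · -- `ω → 0`
    have hs0 : Tendsto s atTop (𝓝 0) := tendsto_biSup_div_of_superlinear hΨ
    have hinv : Tendsto (fun M : ℕ => ((M : ℝ≥0∞) + 1)⁻¹) atTop (𝓝 0) := by
      have h := ENNReal.tendsto_inv_nat_nhds_zero.comp (tendsto_add_atTop_nat 1)
      refine h.congr fun M => ?_
      simp [Function.comp]
    have ht0 : Tendsto t atTop (𝓝 0) := by simpa using hs0.add hinv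
    have hBT : B + 1 ≠ ⊤ := ENNReal.add_ne_top.2 ⟨hB.ne, ENNReal.one_ne_top⟩
    simpa using ENNReal.Tendsto.const_mul ht0 (Or.inr hBT)
  · -- the domination at level `M`
    set Z : Torus.energySpace (Fin 3) → ℝ≥0∞ := fun u =>
      Torus.eGradNormSq (u.1 : UnitAddTorus (Fin 3) → EuclideanSpace ℝ (Fin 3)) with hZ
    have hZm : Measurable Z := Torus.measurable_eGradNormSq_coe
    change ∫⁻ u in {u | (M : ℝ≥0∞) < Z u}, Z u ∂μ ≤ (B + 1) * t M
    by_cases hsT : s M = ⊤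
    · have : t M = ⊤ := by rw [ht]; simp [hsT]
      rw [this, ENNReal.mul_top (by simp)]
      exact le_top
    -- pointwise: on `M < x < ⊤`, `x ≤ t M * Ψ x`
    have ht0 : t M ≠ 0 := by
      rw [ht]; simp
    have htT : t M ≠ ⊤ := ENNReal.add_ne_top.2 ⟨hsT, ENNReal.inv_ne_top.2 (by simp)⟩
    have hpt : ∀ x ∈ Ioo (M : ℝ≥0∞) ⊤, x ≤ t M * Ψ x := by
      intro x hx
      have hx0 : x ≠ 0 := (lt_of_le_of_lt (zero_le (a := (M : ℝ≥0∞))) hx.1).ne'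
      have hle : x / Ψ x ≤ s M := by
        rw [hs]
        exact le_iSup₂ (f := fun x (_ : x ∈ Ioo (M : ℝ≥0∞) ⊤) => x / Ψ x) x hx
      by_cases hΨT : Ψ x = ⊤
      · rw [hΨT, ENNReal.mul_top ht0]; exact le_top
      have hΨ0 : Ψ x ≠ 0 := by
        intro h0
        rw [h0, ENNReal.div_zero hx0] at hle
        exact hsT (top_le_iff.1 hle)
      calc x = x / Ψ x * Ψ x := (ENNReal.div_mul_cancel hΨ0 hΨT).symm
        _ ≤ s M * Ψ x := mul_le_mul' hle le_rfl
        _ ≤ t M * Ψ x := mul_le_mul' le_self_add le_rfl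
    have hmeas : MeasurableSet {u : Torus.energySpace (Fin 3) | (M : ℝ≥0∞) < Z u} :=
      measurableSet_lt measurable_const hZm
    have hae : ∀ᵐ u ∂(μ.restrict {u | (M : ℝ≥0∞) < Z u}), Z u ≤ t M * Ψ (Z u) := by
      filter_upwards [ae_restrict_mem hmeas, ae_restrict_of_ae (hlev)] with u hu hul
      exact hpt (Z u) ⟨hu, CubicParityLoud.Negative.eGradNormSq_lt_top_of_isLevel hul⟩
    calc ∫⁻ u in {u | (M : ℝ≥0∞) < Z u}, Z u ∂μ
        ≤ ∫⁻ u in {u | (M : ℝ≥0∞) < Z u}, t M * Ψ (Z u) ∂μ := lintegral_mono_ae hae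
      _ = t M * ∫⁻ u in {u | (M : ℝ≥0∞) < Z u}, Ψ (Z u) ∂μ := lintegral_const_mul' _ _ htT
      _ ≤ t M * ∫⁻ u, Ψ (Z u) ∂μ := by
          gcongr
          exact Measure.restrict_le_self
      _ ≤ t M * B := mul_le_mul' le_rfl hΨB
      _ ≤ (B + 1) * t M := by
          rw [mul_comm]
          exact mul_le_mul' le_self_add le_rfl

/-! ## The transfer: the loud rung with a superlinear enstrophy moment implies the crux BY NAME -/

/-- **`GalerkinInvariantLoudUI → MomentLadder`** (line `Sketch` / `enstrophy-ui-resolution`, kernel-checked transfer). The hypothesis is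
the loud rung with ONE superlinear enstrophy moment, uniform in the level `N` (the sibling crux `GalerkinInvariantLoud` plus
`∫ Ψ(‖∇u‖²) dμ ≤ B_j`, `Ψ(x)/x → ∞`). Proof: the weighted palinstrophy bound A2 := A2d A2b (A2c A2a) and UI-resolution A3 A1 A2 give, for
`(f, ν_j, R_j)` and the de la Vallée-Poussin modulus `ω_j` of `(Ψ, B_j)`, ONE schedule `κ_j` resolving every admissible law with that modulus;
inside the `∃ᶠ N` the loud invariant law serves every order `d`. A CONDITIONAL result: it credits the crux only when its hypothesis lands.
[folklore] -/
theorem MomentLadder_of_galerkinInvariantLoudUI :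
    (∃ f : UnitAddTorus (Fin 3) → EuclideanSpace ℝ (Fin 3),
      Torus.IsSmooth f ∧ Torus.IsDivFree f ∧ Torus.HasZeroMean f ∧
      ∃ (ν : ℕ → ℝ) (E ε : ℝ) (Ψ : ℝ≥0∞ → ℝ≥0∞),
        (∀ j, 0 < ν j) ∧ Tendsto ν atTop (𝓝 0) ∧ 0 < ε ∧
        Tendsto (fun x : ℝ≥0∞ => Ψ x / x) (𝓝[≠] ⊤) (𝓝 ⊤) ∧
        ∀ j : ℕ, ∃ (R : ℝ) (B : ℝ≥0∞), B < ⊤ ∧ ∃ᶠ N in atTop,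
          ∃ μ : Measure (Torus.energySpace (Fin 3)),
            IsProbabilityMeasure μ ∧ (∀ᵐ u ∂μ, IsLevel N u) ∧ IsSupported R μ ∧
            (∀ d, IsPolyStationary (ν j) f N d μ) ∧
            ∫⁻ u, Ψ (Torus.eGradNormSq (u.1 : UnitAddTorus (Fin 3) → EuclideanSpace ℝ (Fin 3))) ∂μ ≤ B ∧
            Torus.ensembleEnergy μ ≤ E ∧ ε ≤ Torus.ensembleDissipation (ν j) μ) →
    MomentLadder := by
  intro hC
  have hUI := stub_uiResolution stub_tailLePalinstrophy
    (stub_weightedPalinstrophyBound stub_stokesTruncRow (stub_weightStationarity stub_enstrophyTestField))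
  obtain ⟨f, hfs, hfd, hfz, ν, E, ε, Ψ, hν, hν0, hε, hΨ, hj⟩ := hC
  refine momentLadder_iff.2 ⟨f, hfs, hfd, hfz, ν, E, ε, hν, hν0, hε, fun j => ?_⟩
  obtain ⟨R, B, hB, hfreq⟩ := hj j
  obtain ⟨ω, hω0, hωdom⟩ := exists_uiModulus_of_superlinear hΨ hB
  obtain ⟨κ, hκ⟩ := hUI f hfs (ν j) (hν j) R ω hω0
  refine ⟨R, κ, hfreq.mono fun N hN d => ?_⟩
  obtain ⟨μ, hP, hlev, hsupp, hstat, hΨB, hE, hεle⟩ := hN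
  exact ⟨μ, hP, hlev, hsupp, hκ N μ hP hlev hsupp hstat (hωdom μ N hlev hΨB), hstat d, hE, hεle⟩

/-- **`GalerkinInvariantLoudUI → GalerkinInvariantLoud`** (the sibling crux stmt-AnomalousDissipation-14283, by forgetting the moment
clause: polynomial stationarity at every degree is stationarity against every polynomial cylindrical observable). Records that the
residual hypothesis of the line is at least as strong as an open crux of the route. [folklore] -/
theorem galerkinInvariantLoud_of_galerkinInvariantLoudUI :
    (∃ f : UnitAddTorus (Fin 3) → EuclideanSpace ℝ (Fin 3),
      Torus.IsSmooth f ∧ Torus.IsDivFree f ∧ Torus.HasZeroMean f ∧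
      ∃ (ν : ℕ → ℝ) (E ε : ℝ) (Ψ : ℝ≥0∞ → ℝ≥0∞),
        (∀ j, 0 < ν j) ∧ Tendsto ν atTop (𝓝 0) ∧ 0 < ε ∧
        Tendsto (fun x : ℝ≥0∞ => Ψ x / x) (𝓝[≠] ⊤) (𝓝 ⊤) ∧
        ∀ j : ℕ, ∃ (R : ℝ) (B : ℝ≥0∞), B < ⊤ ∧ ∃ᶠ N in atTop,
          ∃ μ : Measure (Torus.energySpace (Fin 3)),
            IsProbabilityMeasure μ ∧ (∀ᵐ u ∂μ, IsLevel N u) ∧ IsSupported R μ ∧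
            (∀ d, IsPolyStationary (ν j) f N d μ) ∧
            ∫⁻ u, Ψ (Torus.eGradNormSq (u.1 : UnitAddTorus (Fin 3) → EuclideanSpace ℝ (Fin 3))) ∂μ ≤ B ∧
            Torus.ensembleEnergy μ ≤ E ∧ ε ≤ Torus.ensembleDissipation (ν j) μ) →
    GalerkinInvariantLoud := by
  intro hC
  obtain ⟨f, hfs, hfd, hfz, ν, E, ε, Ψ, hν, hν0, hε, -, hj⟩ := hC
  refine ⟨f, hfs, hfd, hfz, ν, E, ε, hν, hν0, hε, fun j => ?_⟩
  obtain ⟨R, B, -, hfreq⟩ := hj j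
  refine ⟨R, hfreq.mono fun N hN => ?_⟩
  obtain ⟨μ, hP, hlev, hsupp, hstat, -, hE, hεle⟩ := hN
  exact ⟨μ, hP, hlev, hsupp, fun m g P hg => hstat (P.totalDegree + 1) m g P hg le_rfl, hE, hεle⟩

/-- **Cross-route bridge: `MirrorVariety.GalerkinSteadyZerothLaw → MomentParity.MomentLadder`.** Loud bounded Galerkin STEADY states
along `ν_j → 0` (the crux of route MirrorVariety, stmt-AnomalousDissipation-2986) give the target of route MomentParity: their Dirac masses
are loud invariant level-`N` laws with a superlinear (quadratic) enstrophy moment bounded uniformly in `N` (`stub_steadyCorner`), and the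
transfer `MomentLadder_of_galerkinInvariantLoudUI` supplies the `N`-uniform resolution schedule. Unconditional implication between two
route declarations (both open); it credits neither item. [folklore] -/
theorem MomentLadder_of_galerkinSteadyZerothLaw :
    Summit.AnomalousDissipation.AnomalousDissipation.Theses.MirrorVariety.GalerkinSteadyZerothLaw → MomentLadder :=
  fun h => MomentLadder_of_galerkinInvariantLoudUI (stub_steadyCorner h)

/-! ## The characterization: `MomentLadder` ⟺ the loud rung with a UNIFORMLY INTEGRABLE enstrophy (modulus form) -/

/-- **Transfer, modulus form**: the loud rung with an `N`-free UI modulus of the enstrophy implies the crux (A3 directly). [folklore] -/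
theorem MomentLadder_of_mod :
    (∃ f : UnitAddTorus (Fin 3) → EuclideanSpace ℝ (Fin 3),
      Torus.IsSmooth f ∧ Torus.IsDivFree f ∧ Torus.HasZeroMean f ∧
      ∃ (ν : ℕ → ℝ) (E ε : ℝ), (∀ j, 0 < ν j) ∧ Tendsto ν atTop (𝓝 0) ∧ 0 < ε ∧
        ∀ j : ℕ, ∃ (R : ℝ) (ω : ℕ → ℝ≥0∞), Tendsto ω atTop (𝓝 0) ∧ ∃ᶠ N in atTop,
          ∃ μ : Measure (Torus.energySpace (Fin 3)),
            IsProbabilityMeasure μ ∧ (∀ᵐ u ∂μ, IsLevel N u) ∧ IsSupported R μ ∧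
            (∀ d, IsPolyStationary (ν j) f N d μ) ∧
            (∀ M : ℕ, ∫⁻ u in {u : Torus.energySpace (Fin 3) |
                (M : ℝ≥0∞) < Torus.eGradNormSq (u.1 : UnitAddTorus (Fin 3) → EuclideanSpace ℝ (Fin 3))},
                Torus.eGradNormSq (u.1 : UnitAddTorus (Fin 3) → EuclideanSpace ℝ (Fin 3)) ∂μ ≤ ω M) ∧
            Torus.ensembleEnergy μ ≤ E ∧ ε ≤ Torus.ensembleDissipation (ν j) μ) →
    MomentLadder := by
  intro hC
  have hUI := stub_uiResolution stub_tailLePalinstrophy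
    (stub_weightedPalinstrophyBound stub_stokesTruncRow (stub_weightStationarity stub_enstrophyTestField))
  obtain ⟨f, hfs, hfd, hfz, ν, E, ε, hν, hν0, hε, hj⟩ := hC
  refine momentLadder_iff.2 ⟨f, hfs, hfd, hfz, ν, E, ε, hν, hν0, hε, fun j => ?_⟩
  obtain ⟨R, ω, hω0, hfreq⟩ := hj j
  obtain ⟨κ, hκ⟩ := hUI f hfs (ν j) (hν j) R ω hω0
  refine ⟨R, κ, hfreq.mono fun N hN d => ?_⟩
  obtain ⟨μ, hP, hlev, hsupp, hstat, hω, hE, hεle⟩ := hN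
  exact ⟨μ, hP, hlev, hsupp, hκ N μ hP hlev hsupp hstat hω, hstat d, hE, hεle⟩

/-- **The converse: `MomentLadder` implies the loud rung in modulus form.** At each `j`: moment closure at every degree (B1) turns the
order-by-order witnesses at fixed `(N, R_j, κ_j)` into ONE invariant law with the same bounds, and resolution ⇒ UI (B2) gives the explicit
modulus `ω_j M = inf {2/(n+1) : 8π²κ_j(n)²R_j² ≤ M}`, which depends on `j` only. [folklore] -/
theorem mod_of_MomentLadder (h : MomentLadder) :
    ∃ f : UnitAddTorus (Fin 3) → EuclideanSpace ℝ (Fin 3),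
      Torus.IsSmooth f ∧ Torus.IsDivFree f ∧ Torus.HasZeroMean f ∧
      ∃ (ν : ℕ → ℝ) (E ε : ℝ), (∀ j, 0 < ν j) ∧ Tendsto ν atTop (𝓝 0) ∧ 0 < ε ∧
        ∀ j : ℕ, ∃ (R : ℝ) (ω : ℕ → ℝ≥0∞), Tendsto ω atTop (𝓝 0) ∧ ∃ᶠ N in atTop,
          ∃ μ : Measure (Torus.energySpace (Fin 3)),
            IsProbabilityMeasure μ ∧ (∀ᵐ u ∂μ, IsLevel N u) ∧ IsSupported R μ ∧
            (∀ d, IsPolyStationary (ν j) f N d μ) ∧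
            (∀ M : ℕ, ∫⁻ u in {u : Torus.energySpace (Fin 3) |
                (M : ℝ≥0∞) < Torus.eGradNormSq (u.1 : UnitAddTorus (Fin 3) → EuclideanSpace ℝ (Fin 3))},
                Torus.eGradNormSq (u.1 : UnitAddTorus (Fin 3) → EuclideanSpace ℝ (Fin 3)) ∂μ ≤ ω M) ∧
            Torus.ensembleEnergy μ ≤ E ∧ ε ≤ Torus.ensembleDissipation (ν j) μ := by
  obtain ⟨f, hfs, hfd, hfz, ν, E, ε, hν, hν0, hε, hj⟩ := momentLadder_iff.1 h
  refine ⟨f, hfs, hfd, hfz, ν, E, ε, hν, hν0, hε, fun j => ?_⟩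
  obtain ⟨R, κ, hfreq⟩ := hj j
  -- the explicit `N`-free modulus `ω M = inf {2/(n+1) : 8π²κ(n)²R² ≤ M}` and its decay
  set ω : ℕ → ℝ≥0∞ := fun M =>
    ⨅ n ∈ {n : ℕ | 8 * Real.pi ^ 2 * ((κ n : ℕ) : ℝ) ^ 2 * R ^ 2 ≤ (M : ℝ)}, 2 * ((n : ℝ≥0∞) + 1)⁻¹ with hω
  have hω0 : Tendsto ω atTop (𝓝 0) := by
    rw [ENNReal.tendsto_nhds_zero]
    intro ε' hε'
    have h2 : Tendsto (fun n : ℕ => (2 : ℝ≥0∞) * ((n : ℝ≥0∞) + 1)⁻¹) atTop (𝓝 0) := by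
      have hc := ENNReal.tendsto_inv_nat_nhds_zero.comp (tendsto_add_atTop_nat 1)
      have h' : Tendsto (fun n : ℕ => ((n : ℝ≥0∞) + 1)⁻¹) atTop (𝓝 0) :=
        hc.congr fun n => by simp [Function.comp]
      simpa using ENNReal.Tendsto.const_mul h' (Or.inr ENNReal.ofNat_ne_top)
    obtain ⟨n, hn⟩ := ((ENNReal.tendsto_nhds_zero.1 h2) ε' hε').exists
    obtain ⟨M₀, hM₀⟩ := exists_nat_ge (8 * Real.pi ^ 2 * ((κ n : ℕ) : ℝ) ^ 2 * R ^ 2)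
    refine eventually_atTop.2 ⟨M₀, fun M hM => ?_⟩
    refine (iInf₂_le n ?_).trans hn
    exact hM₀.trans (by exact_mod_cast hM)
  refine ⟨R, ω, hω0, hfreq.mono fun N hN => ?_⟩
  obtain ⟨μ, hP, hlev, hsupp, hres, hstat, hE, hεle⟩ := stub_closureAllDegrees f hfs (ν j) N E ε R κ hN
  refine ⟨μ, hP, hlev, hsupp, hstat, fun M => ?_, hE, hεle⟩
  refine le_iInf₂ fun n hn => ?_
  refine le_trans ?_ (stub_resolutionUI R κ μ hP hsupp hres n)
  refine lintegral_mono_set fun u hu => ?_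
  have hu' : (M : ℝ≥0∞) < Torus.eGradNormSq (u.1 : UnitAddTorus (Fin 3) → EuclideanSpace ℝ (Fin 3)) := hu
  have hM : ENNReal.ofReal (8 * Real.pi ^ 2 * ((κ n : ℕ) : ℝ) ^ 2 * R ^ 2) ≤ (M : ℝ≥0∞) := by
    have h := ENNReal.ofReal_le_ofReal hn
    simpa using h
  exact lt_of_le_of_lt hM hu'

/-- **Characterization.** `MomentParity.MomentLadder` ⟺ for some smooth div-free mean-zero force, `ν_j → 0`, `E`, `ε > 0`: at every `j` a radius
`R_j` and an `N`-FREE UI modulus `ω_j → 0` such that for infinitely many levels `N` a level-`N` probability law supported in `‖u‖ ≤ R_j`, stationary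
for Galerkin NS at `(ν_j, f)` against every polynomial cylindrical observable with band-limited fields, has `∫_{‖∇u‖² > M} ‖∇u‖² dμ ≤ ω_j M` for all
`M`, mean energy `≤ E` and dissipation `≥ ε`. The resolution schedule of the crux is exactly uniform integrability of the enstrophy along the levels.
Unconditional. [folklore] -/
theorem momentLadder_iff_mod :
    MomentLadder ↔ ∃ f : UnitAddTorus (Fin 3) → EuclideanSpace ℝ (Fin 3),
      Torus.IsSmooth f ∧ Torus.IsDivFree f ∧ Torus.HasZeroMean f ∧
      ∃ (ν : ℕ → ℝ) (E ε : ℝ), (∀ j, 0 < ν j) ∧ Tendsto ν atTop (𝓝 0) ∧ 0 < ε ∧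
        ∀ j : ℕ, ∃ (R : ℝ) (ω : ℕ → ℝ≥0∞), Tendsto ω atTop (𝓝 0) ∧ ∃ᶠ N in atTop,
          ∃ μ : Measure (Torus.energySpace (Fin 3)),
            IsProbabilityMeasure μ ∧ (∀ᵐ u ∂μ, IsLevel N u) ∧ IsSupported R μ ∧
            (∀ d, IsPolyStationary (ν j) f N d μ) ∧
            (∀ M : ℕ, ∫⁻ u in {u : Torus.energySpace (Fin 3) |
                (M : ℝ≥0∞) < Torus.eGradNormSq (u.1 : UnitAddTorus (Fin 3) → EuclideanSpace ℝ (Fin 3))},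
                Torus.eGradNormSq (u.1 : UnitAddTorus (Fin 3) → EuclideanSpace ℝ (Fin 3)) ∂μ ≤ ω M) ∧
            Torus.ensembleEnergy μ ≤ E ∧ ε ≤ Torus.ensembleDissipation (ν j) μ :=
  ⟨mod_of_MomentLadder, MomentLadder_of_mod⟩

end Summit.AnomalousDissipation.AnomalousDissipation.Theorems.MomentLadder

end
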